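import Literature.Probability.RandomPlanarGeometry.SLEOnePointEstimate
import Literature.Probability.RandomPlanarGeometry.CritPercSLEDimensionLower
import HarnessLib

/-!
# The Hausdorff dimension of the SLE_κ trace is a.s. at most `1 + κ/8` (Rohde–Schramm, Cor. 8.2), proved

Topic `Probability/RandomPlanarGeometry`; dimension block of **crit-perc.S20**
(`Literature.Probability.RandomPlanarGeometry.ae_dimH_range_sleTrace`, Beffara, Ann. Probab. 36
(2008), Thm 1: a.s. `dim_H γ[0,∞) = 1 + κ/8` for `0 < κ ≤ 8`). The sibling
`CritPercSLEDimensionUpper.lean` derives the a.s. upper bound from a *hypothesised* one-point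
estimate with the sharp exponent `ε^{1-κ/8}` (`ae_dimH_range_sleTrace_le_of_onePoint_upper'`);
here we **prove the upper bound outright**

  `0 < κ < 8`, `HasSLETrace κ` ⟹ a.s. `dim_H (range (sleTrace κ)) ≤ 1 + κ/8`   (`ae_dimH_range_sleTrace_le`)

— Rohde–Schramm, *Basic properties of SLE*, Ann. of Math. 161 (2005), **Cor. 8.2** ("For `κ < 8`,
the Hausdorff dimension of `γ[0,∞)` is a.s. bounded above by `1 + κ/8`", from Thm 8.1), under the
sole input that SLE_κ is generated by a curve (`HasSLETrace κ`, Thm 5.1, the root named fact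
`hasSLETrace_of_ne_eight` of the prelude; Beffara likewise takes the upper bound from [RS05]).

Assembly of the proved layers:

* `SLEMomentSupersolution` + `SLEDerivRatioMoments`: `E[sup_{t<τ(z)} ψₜ(z)^a] ≤ C` for all
  `a < 1 - κ/8`, uniformly in `z ∈ ℍ` (Lemma 6.3 with elementary supersolutions);
* `SLEOnePointEstimate`: `P[dist(z, γ) ≤ ε] ≤ C (ε/Im z)^a` (eq. (6.2) + Markov), which on a
  compact `K ⊆ ℍ` (where `Im z ≥ m > 0`) is the hypothesis `hA` of the sibling's covering theorem
  `ae_dimH_range_sleTrace_le_of_onePoint_upper` with exponent `s = a`;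
* hence a.s. `dim_H γ[0,∞) ≤ 2 - a` for every `a < 1 - κ/8`, and letting `a ↑ 1 - κ/8` along a
  sequence (`ae_all_iff`) gives `≤ 1 + κ/8` — the sharp exponent is never needed for the upper
  bound. (An SLE-free form of the covering step is `Literature.MeasureTheory.Hausdorff.FirstMomentCovering`.)

Consequences for Beffara's theorem: with the proved 0–1 law (`CritPercSLEDimensionZeroOne`,
Beffara's Lemma 3) the fact `ae_dimH_range_sleTrace` (`0 < κ ≤ 8`) follows from the Rohde–Schramm /
Lawler–Schramm–Werner root facts and the single **lower-bound** statement
"`P[dim_H γ[0,∞) ≥ 1 + κ/8] > 0` for `0 < κ < 8`" (`ae_dimH_range_sleTrace_of_measure_ge_pos`);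
and, through the proved second-moment passage of `CritPercSLEDimensionLower.lean` (Beffara's
Prop. 1 (2)), from the root facts plus the **lower** half of the one-point estimate (Beffara Prop. 4 /
Lawler (2005) Thm. 7.9) and the two-point estimate (3.5) alone
(`ae_dimH_range_sleTrace_of_root_facts_of_lower_estimates`,
`ae_dimH_range_sleTrace_of_root_facts_of_onePoint_lower_of_twoPoint`) — the hypothesis `hU` /
the upper half of Prop. 4 of the sibling assemblies is discharged by this file.

## References

* S. Rohde, O. Schramm, *Basic properties of SLE*, Ann. of Math. 161 (2005): Lemma 6.3, eq. (6.2)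
  (p. 903), Thm 8.1 and Cor 8.2 (p. 914), Thm 5.1.
* V. Beffara, *The dimension of the SLE curves*, Ann. Probab. 36 (2008) 1421–1452, Thm 1, §1.
-/

noncomputable section

open Set Filter MeasureTheory Metric Complex
open _root_.Topology
open UpperHalfPlane (upperHalfPlaneSet)
open scoped NNReal ENNReal Real

namespace Literature.Probability.RandomPlanarGeometry

open Loewner Literature.Probability.Process Literature.MeasureTheory.Hausdorff

variable {κ : ℝ≥0}

/-! ### Rohde–Schramm's Corollary 8.2 -/

/-- **The one-point estimate on a compact set, in the sibling's format**: for `0 < κ < 8`,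
`0 < a < 1 - κ/8`, `HasSLETrace κ` and a compact `K ⊆ ℍ` there are `c₂ < ∞` and `ε₀ = 1` with
`P[dist(z, γ[0,∞)) ≤ ε] ≤ c₂ ε^a` for `z ∈ K`, `0 < ε ≤ 1` (`measure_infDist_sleTrace_le` with
`Im z ≥ min_K Im > 0`). [cite: RohdeSchramm2005, Thm 8.1] -/
theorem exists_onePoint_upper_of_isCompact (hκ0 : 0 < κ) {a : ℝ} (ha : 0 < a)
    (ha8 : a < 1 - (κ : ℝ) / 8) (hT : HasSLETrace κ) (K : Set ℂ) (hK : IsCompact K)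
    (hKH : K ⊆ upperHalfPlaneSet) :
    ∃ c₂ : ℝ≥0∞, c₂ ≠ ⊤ ∧ ∃ ε₀ : ℝ, 0 < ε₀ ∧ ∀ ε : ℝ, 0 < ε → ε ≤ ε₀ → ∀ z ∈ K,
      preWienerMeasure {ω | infDist z (range (sleTrace κ ω)) ≤ ε} ≤ c₂ * ENNReal.ofReal (ε ^ a) := by
  obtain ⟨C, hC⟩ := measure_infDist_sleTrace_le hκ0 ha ha8 hT
  rcases K.eq_empty_or_nonempty with rfl | hne
  · exact ⟨0, ENNReal.zero_ne_top, 1, one_pos, fun ε _ _ z hz ↦ (notMem_empty z hz).elim⟩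
  -- `Im` attains a positive minimum `m` on `K`
  obtain ⟨z₀, hz₀K, hz₀⟩ := hK.exists_isMinOn hne Complex.continuous_im.continuousOn
  set m : ℝ := z₀.im with hm
  have hm0 : 0 < m := hKH hz₀K
  refine ⟨C * ENNReal.ofReal ((1 / m) ^ a), ENNReal.mul_ne_top ENNReal.coe_ne_top ENNReal.ofReal_ne_top,
    1, one_pos, fun ε hε _ z hz ↦ ?_⟩
  have hzim : m ≤ z.im := hz₀ hz
  have hzpos : 0 < z.im := hm0.trans_le hzim
  refine (hC hzpos hε).trans ?_
  rw [mul_assoc, ← ENNReal.ofReal_mul (Real.rpow_nonneg (by positivity) a),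
    ← Real.mul_rpow (by positivity) hε.le]
  refine mul_le_mul_right (ENNReal.ofReal_le_ofReal (Real.rpow_le_rpow (by positivity) ?_ ha.le)) _
  rw [one_div_mul_eq_div]
  exact div_le_div_of_nonneg_left hε.le hm0 hzim

/-- **Rohde–Schramm (2005), Cor. 8.2 (proved, given Thm 5.1)**: for `0 < κ < 8`, if SLE_κ is
generated by a curve (`HasSLETrace κ`), then almost surely
`dim_H (range (sleTrace κ ω)) ≤ 1 + κ/8`. ("For `κ < 8`, the Hausdorff dimension of `γ[0,∞)` is
a.s. bounded above by `1 + κ/8`.") The printed `κ < 8` includes `κ = 0` (the segment `[0, 2i√t]`,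
dimension `1`), not covered here since the prelude's trace and Lemma 6.3 are set up for `κ > 0`.
Proof: for each `a_m = (1 - κ/8)(1 - 1/(m+2))` the one-point estimate with exponent `a_m`
(`exists_onePoint_upper_of_isCompact`: Lemma 6.3 for all moments via elementary supersolutions,
eq. (6.2), Markov) feeds the covering theorem `ae_dimH_range_sleTrace_le_of_onePoint_upper`
(the dyadic covering argument of Thm 8.1), giving a.s. `dim_H ≤ 2 - a_m`; intersect over `m`.
[cite: RohdeSchramm2005, Cor 8.2] -/
theorem ae_dimH_range_sleTrace_le (hκ0 : 0 < κ) (hκ8 : κ < 8) (hT : HasSLETrace κ) :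
    ∀ᵐ ω ∂preWienerMeasure, dimH (range (sleTrace κ ω)) ≤ 1 + (κ : ℝ≥0∞) / 8 := by
  set s₀ : ℝ := 1 - (κ : ℝ) / 8 with hs₀
  have hκ8' : (κ : ℝ) < 8 := by exact_mod_cast hκ8
  have hs₀pos : 0 < s₀ := by rw [hs₀]; linarith
  have hs₀1 : s₀ ≤ 1 := by rw [hs₀]; linarith [κ.coe_nonneg]
  -- exponents `a m = s₀ - s₀/(m+2) ↑ s₀`
  set a : ℕ → ℝ := fun m ↦ s₀ - s₀ / ((m : ℝ) + 2) with ha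
  have hapos : ∀ m, 0 < a m := fun m ↦ by
    have h2 : (2 : ℝ) ≤ (m : ℝ) + 2 := by linarith [(Nat.cast_nonneg m : (0 : ℝ) ≤ m)]
    have : s₀ / ((m : ℝ) + 2) ≤ s₀ / 2 := div_le_div_of_nonneg_left hs₀pos.le two_pos h2
    simp only [ha]; linarith
  have halt : ∀ m, a m < s₀ := fun m ↦ by
    have : 0 < s₀ / ((m : ℝ) + 2) := by positivity
    simp only [ha]; linarith
  have hm : ∀ m : ℕ, ∀ᵐ ω ∂preWienerMeasure,
      dimH (range (sleTrace κ ω)) ≤ ENNReal.ofReal (2 - a m) := fun m ↦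
    ae_dimH_range_sleTrace_le_of_onePoint_upper hT ((halt m).le.trans hs₀1)
      (exists_onePoint_upper_of_isCompact hκ0 (hapos m) (halt m) hT)
  rw [← ae_all_iff] at hm
  filter_upwards [hm] with ω hω
  refine ENNReal.le_of_forall_pos_le_add fun ε hε _ ↦ ?_
  -- choose `m` with `s₀/(m+2) ≤ ε`
  obtain ⟨m, hmε⟩ := exists_nat_one_div_lt (div_pos hε hs₀pos : (0 : ℝ) < ε / s₀)
  have hδ : s₀ / ((m : ℝ) + 2) ≤ ε := by
    have h1 : s₀ / ((m : ℝ) + 2) ≤ s₀ / ((m : ℝ) + 1) :=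
      div_le_div_of_nonneg_left hs₀pos.le (by positivity) (by linarith)
    have h2 : s₀ / ((m : ℝ) + 1) = s₀ * (1 / ((m : ℝ) + 1)) := by ring
    have h3 : s₀ * (1 / ((m : ℝ) + 1)) ≤ s₀ * (ε / s₀) := mul_le_mul_of_nonneg_left hmε.le hs₀pos.le
    rw [mul_div_cancel₀ _ hs₀pos.ne'] at h3
    linarith
  refine (hω m).trans ?_
  have hsplit : 2 - a m = (1 + (κ : ℝ) / 8) + s₀ / ((m : ℝ) + 2) := by simp only [ha, hs₀]; ring
  rw [hsplit, ENNReal.ofReal_add (by positivity) (by positivity), ENNReal.ofReal_add zero_le_one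
    (by positivity), ENNReal.ofReal_one, ENNReal.ofReal_div_of_pos (by norm_num),
    ENNReal.ofReal_coe_nnreal, ENNReal.ofReal_ofNat]
  gcongr
  rw [← ENNReal.ofReal_coe_nnreal]
  exact ENNReal.ofReal_le_ofReal hδ

/-- Cor. 8.2 from the root fact `hasSLETrace_of_ne_eight` (Rohde–Schramm Thm 5.1): for
`0 < κ < 8`, a.s. `dim_H (range (sleTrace κ ω)) ≤ 1 + κ/8` — the hypothesis `hU` of
`ae_dimH_range_sleTrace_of_ae_le_of_pos_of_zero_one` (`CritPercSLEDimension.lean`) and of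
`ae_dimH_range_sleTrace_of_root_facts_of_estimates` (`CritPercSLEDimensionLower.lean`).
[cite: RohdeSchramm2005, Cor 8.2] -/
theorem ae_dimH_range_sleTrace_le_of_hasSLETrace (hne : hasSLETrace_of_ne_eight) (hκ0 : 0 < κ)
    (hκ8 : κ < 8) :
    ∀ᵐ ω ∂preWienerMeasure, dimH (range (sleTrace κ ω)) ≤ 1 + (κ : ℝ≥0∞) / 8 :=
  ae_dimH_range_sleTrace_le hκ0 hκ8 (hne hκ8.ne)

/-! ### Beffara's theorem reduced to the lower bound with positive probability -/

/-- **`P[dim_H = 1 + κ/8] > 0` from `P[dim_H ≥ 1 + κ/8] > 0`** (`0 < κ < 8`), by the proved upper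
bound and `measure_setOf_dimH_eq_pos_of_ae_le`. [cite: Beffara2008, §1 p. 1425] -/
theorem measure_dimH_range_sleTrace_eq_pos_of_ge_pos (hne : hasSLETrace_of_ne_eight) (hκ0 : 0 < κ)
    (hκ8 : κ < 8)
    (hL : 0 < preWienerMeasure {ω | 1 + (κ : ℝ≥0∞) / 8 ≤ dimH (range (sleTrace κ ω))}) :
    0 < preWienerMeasure {ω | dimH (range (sleTrace κ ω)) = 1 + (κ : ℝ≥0∞) / 8} :=
  measure_setOf_dimH_eq_pos_of_ae_le (ae_dimH_range_sleTrace_le_of_hasSLETrace hne hκ0 hκ8) hL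

/-- **Beffara's theorem (crit-perc.S20, `ae_dimH_range_sleTrace`, `0 < κ ≤ 8`) from the root facts
and the lower bound alone.** Given Rohde–Schramm's Thm 5.1 (`hasSLETrace_of_ne_eight`), the
space-filling phase at `κ = 8` (`ae_isSpaceFilling_sleTrace_of_eight_le`, RS05 Cor 7.4 + Update /
LSW04), and the single remaining statement of Beffara's proof — for `0 < κ < 8`,
`P[dim_H γ[0,∞) ≥ 1 + κ/8] > 0` (Beffara (2008), §1 p. 1425: Prop. 1 with Prop. 4 / Cor. 5 and
the two-point estimate (3.5)) — the dimension of the SLE_κ trace is a.s. `1 + κ/8`: upper bound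
`ae_dimH_range_sleTrace_le` (RS05 Cor 8.2, proved here), 0–1 law
`ae_dimH_range_sleTrace_eq_or_ae_ne` (Beffara Lemma 3, proved in `CritPercSLEDimensionZeroOne`),
assembly `ae_dimH_range_sleTrace_of_measure_pos`. [cite: Beffara2008, Thm 1] -/
theorem ae_dimH_range_sleTrace_of_measure_ge_pos (hne : hasSLETrace_of_ne_eight)
    (hSF : ae_isSpaceFilling_sleTrace_of_eight_le (κ := 8))
    (hL : ∀ {κ : ℝ≥0}, 0 < κ → κ < 8 →
      0 < preWienerMeasure {ω | 1 + (κ : ℝ≥0∞) / 8 ≤ dimH (range (sleTrace κ ω))})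
    {κ : ℝ≥0} : ae_dimH_range_sleTrace (κ := κ) :=
  ae_dimH_range_sleTrace_of_measure_pos hne hSF
    fun hκ0 hκ8 ↦ measure_dimH_range_sleTrace_eq_pos_of_ge_pos hne hκ0 hκ8 (hL hκ0 hκ8)

/-- The same with the `κ = 8` input traced back to the Rohde–Schramm / Lawler–Schramm–Werner root
facts (`ae_isSpaceFilling_sleTrace_of_eight_le_of_facts`). [cite: Beffara2008, Thm 1] -/
theorem ae_dimH_range_sleTrace_of_measure_ge_pos' (h8 : hasSLETrace_eight)
    (hne : hasSLETrace_of_ne_eight) (htr : tendsto_norm_sleTrace_atTop)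
    (hd : ae_infDist_sleTrace_eq_zero_of_eight_le)
    (hL : ∀ {κ : ℝ≥0}, 0 < κ → κ < 8 →
      0 < preWienerMeasure {ω | 1 + (κ : ℝ≥0∞) / 8 ≤ dimH (range (sleTrace κ ω))})
    {κ : ℝ≥0} : ae_dimH_range_sleTrace (κ := κ) :=
  ae_dimH_range_sleTrace_of_measure_ge_pos hne
    (ae_isSpaceFilling_sleTrace_of_eight_le_of_facts h8 hne htr hd) hL

/-! ### Beffara's theorem from the root facts and the lower-bound estimates alone -/

/-- **`ae_dimH_range_sleTrace` from the root facts, the lower one-point estimate and the two-point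
estimate along a window** — `ae_dimH_range_sleTrace_of_root_facts_of_estimates`
(`CritPercSLEDimensionLower.lean`) with its hypothesis `hU` (a.s. upper bound) discharged by
`ae_dimH_range_sleTrace_le_of_hasSLETrace`. [cite: Beffara2008, Thm 1] -/
theorem ae_dimH_range_sleTrace_of_root_facts_of_lower_estimates (h8 : hasSLETrace_eight)
    (hne : hasSLETrace_of_ne_eight) (htr : tendsto_norm_sleTrace_atTop)
    (hd : ae_infDist_sleTrace_eq_zero_of_eight_le)
    (hest : ∀ {κ : ℝ≥0}, 0 < κ → κ < 8 →
      ∃ (K : Set ℂ) (ε : ℕ → ℝ) (c₁ c₃ : ℝ≥0∞), IsCompact K ∧ volume K ≠ 0 ∧ (∀ n, 0 < ε n) ∧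
        Antitone ε ∧ Tendsto ε atTop (𝓝 0) ∧ c₁ ≠ 0 ∧ c₃ ≠ ⊤ ∧
        (∀ n, ∀ z ∈ K, c₁ * ENNReal.ofReal (ε n ^ (1 - (κ : ℝ) / 8)) ≤
          preWienerMeasure {ω | infDist z (range (sleTrace κ ω)) ≤ ε n}) ∧
        (∀ n, ∀ x ∈ K, ∀ y ∈ K,
          preWienerMeasure {ω | infDist x (range (sleTrace κ ω)) ≤ ε n ∧
              infDist y (range (sleTrace κ ω)) ≤ ε n} ≤
            c₃ * ENNReal.ofReal (ε n ^ (1 - (κ : ℝ) / 8)) ^ 2 * rieszKernel (1 - (κ : ℝ) / 8) x y))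
    {κ : ℝ≥0} : ae_dimH_range_sleTrace (κ := κ) :=
  ae_dimH_range_sleTrace_of_root_facts_of_estimates h8 hne htr hd
    (fun {_} hκ0 hκ8 ↦ ae_dimH_range_sleTrace_le_of_hasSLETrace hne hκ0 hκ8) hest

/-- **`ae_dimH_range_sleTrace` from the root facts and the two lower-bound SLE estimates of
Beffara's proof in their printed local form** — `ae_dimH_range_sleTrace_of_root_facts_of_local_estimates`
with `hU` discharged: the remaining non-formalised inputs of the fact are exactly

* `hB` — the **lower** half of the one-point estimate: for every compact `K ⊆ ℍ` there are `c₁ > 0`,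
  `ε₀ > 0` with `c₁ ε^{1-κ/8} ≤ P(dist(z, γ[0,∞)) ≤ ε)` for `z ∈ K`, `0 < ε ≤ ε₀` (Beffara (2008),
  Prop. 4 / Cor. 5; Lawler (2005), Thm. 7.9, lower half);
* `hC` — the two-point estimate (Beffara (2008), §3 (3.5); Lawler–Werness (2013), Thm. 2).

The upper bound (Rohde–Schramm Cor. 8.2, this file), the zero-one law (Lemma 3) and the second
moment method (Prop. 1) are proved. [cite: Beffara2008, Thm 1] -/
theorem ae_dimH_range_sleTrace_of_root_facts_of_onePoint_lower_of_twoPoint (h8 : hasSLETrace_eight)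
    (hne : hasSLETrace_of_ne_eight) (htr : tendsto_norm_sleTrace_atTop)
    (hd : ae_infDist_sleTrace_eq_zero_of_eight_le)
    (hB : ∀ {κ : ℝ≥0}, 0 < κ → κ < 8 → ∀ K : Set ℂ, IsCompact K → K ⊆ upperHalfPlaneSet →
      ∃ c₁ : ℝ≥0∞, c₁ ≠ 0 ∧ ∃ ε₀ : ℝ, 0 < ε₀ ∧ ∀ ε : ℝ, 0 < ε → ε ≤ ε₀ → ∀ z ∈ K,
        c₁ * ENNReal.ofReal (ε ^ (1 - (κ : ℝ) / 8)) ≤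
          preWienerMeasure {ω | infDist z (range (sleTrace κ ω)) ≤ ε})
    (hC : ∀ {κ : ℝ≥0}, 0 < κ → κ < 8 → ∀ K : Set ℂ, IsCompact K → K ⊆ upperHalfPlaneSet →
      ∃ c₃ : ℝ≥0∞, c₃ ≠ ⊤ ∧ ∃ ε₀ : ℝ, 0 < ε₀ ∧ ∀ ε : ℝ, 0 < ε → ε ≤ ε₀ → ∀ x ∈ K, ∀ y ∈ K,
        preWienerMeasure {ω | infDist x (range (sleTrace κ ω)) ≤ ε ∧
            infDist y (range (sleTrace κ ω)) ≤ ε} ≤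
          c₃ * ENNReal.ofReal (ε ^ (1 - (κ : ℝ) / 8)) ^ 2 * rieszKernel (1 - (κ : ℝ) / 8) x y)
    {κ : ℝ≥0} : ae_dimH_range_sleTrace (κ := κ) :=
  ae_dimH_range_sleTrace_of_root_facts_of_local_estimates h8 hne htr hd
    (fun {_} hκ0 hκ8 ↦ ae_dimH_range_sleTrace_le_of_hasSLETrace hne hκ0 hκ8) hB hC

end Literature.Probability.RandomPlanarGeometry
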